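import Mathlib
import Literature.Computability.AlgebraicComplexity.NewtonPolygonTauProductBounds
import Summits.ValiantsHypothesis.ValiantsHypothesis.Theorems.NewtonUnitEquationsDissociatedUniformTotalsLawStaircase
import Summits.ValiantsHypothesis.ValiantsHypothesis.Theorems.NewtonUnitEquationsDissociatedUniformTotalsLawDominance
import HarnessLib

/-!
# Crux `NewtonUnitEquations.DissociatedUniform` (stmt-ValiantsHypothesis-5905): the `n = 3` totals law — DOMINANCE SUMS OF ANY RANK
# (`#vert conv {v i + b j : ρ_k i < γ_k j for all k ≤ r} ≤ 4·K^r·(#R + #C)`: the tool for Bohr sets / boxes of rank `r + 1`)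

Memo `Cruxes/DissociatedUniform/NOTES-t1g17.md` §3/§6.  `…TotalsLawDominance` bounds TWO-dimensional dominance sums by a segment-tree
decomposition of the first coordinate over the staircase bound of `…TotalsLawStaircase`.  Iterating the decomposition once per extra
coordinate gives the rank-`r+1` form: for a LIST `L` of `r` coordinate pairs `(ρ_k, γ_k)` (column positions `< 2^K`, no injectivity) and a
last pair `(ρ, γ)` with injective positions, the restricted sum over the relation "`ρ_k i < γ_k j` for every listed `k`, and `ρ i < γ j`"
(`Stair.domPtsL R C (L ++ [(ρ, γ)])`) has **at most `4·K^r·(#R + #C)` hull vertices** (`Stair.ncard_extremePoints_domPtsL_le`, induction on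
`L`: `Stair.domPtsL_cons_eq_biUnion` peels the head coordinate into the `K·2^K` dyadic nodes of `…Dominance`, whose row sets are disjoint per
level).  With `r = 0` this is the staircase bound, with `r = 1` the dominance bound.  Intended use: unions of translated BOXES OF RANK `r+1`
(rank-`(r+1)` Bohr sets in products of cyclic groups) reduce block by block to such sums exactly as in `…TotalsLawBoxWindows` (not done here),
giving `O(|G| log^r |G|)` pointwise union bounds.  Honest label: a planar incidence tool; `UnionTotalsLaw C`, `TotalsLawThree C` remain OPEN
and are asserted nowhere; nothing here bears on VP ≠ VNP.
[folklore: range-tree decomposition of a dominance relation into products]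
-/

set_option linter.dupNamespace false -- `ValiantsHypothesis.ValiantsHypothesis` (summit = problem) in every name

open Matrix Finset
open scoped BigOperators Pointwise

namespace Summit.ValiantsHypothesis.ValiantsHypothesis.Theorems.NewtonUnitEquationsDissociatedUniform

namespace TotalsLaw

namespace Stair

open Literature.Computability.AlgebraicComplexity.KPTT.PlanarMinkowski

variable {ι κ : Type*}

section Geometry

variable {R : Finset ι} {C : Finset κ} {v : ι → (Fin 2 → ℝ)} {b : κ → (Fin 2 → ℝ)}

/-- The rank-`r` dominance relation of a list of coordinate pairs: `ρ_k i < γ_k j` for every listed `(ρ_k, γ_k)`. -/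
def DomRel (L : List ((ι → ℕ) × (κ → ℕ))) (i : ι) (j : κ) : Prop := ∀ p ∈ L, p.1 i < p.2 j

/-- `DomRel` of a cons. [folklore] -/
theorem domRel_cons {p : (ι → ℕ) × (κ → ℕ)} {L : List ((ι → ℕ) × (κ → ℕ))} {i : ι} {j : κ} :
    DomRel (p :: L) i j ↔ p.1 i < p.2 j ∧ DomRel L i j := by
  simp [DomRel]

/-- `DomRel` of a singleton. [folklore] -/
theorem domRel_singleton {p : (ι → ℕ) × (κ → ℕ)} {i : ι} {j : κ} : DomRel [p] i j ↔ p.1 i < p.2 j := by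
  simp [DomRel]

open Classical in
/-- The rank-`r` DOMINANCE SUM `{v i + b j : i ∈ R, j ∈ C, ρ_k i < γ_k j ∀k}` of a list of coordinate pairs. -/
noncomputable def domPtsL (R : Finset ι) (C : Finset κ) (L : List ((ι → ℕ) × (κ → ℕ))) (v : ι → (Fin 2 → ℝ))
    (b : κ → (Fin 2 → ℝ)) : Finset (Fin 2 → ℝ) :=
  ((R ×ˢ C).filter fun p => DomRel L p.1 p.2).image fun p => v p.1 + b p.2

/-- Membership in `domPtsL`. [folklore] -/
theorem mem_domPtsL {L : List ((ι → ℕ) × (κ → ℕ))} {x : Fin 2 → ℝ} :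
    x ∈ domPtsL R C L v b ↔ ∃ i ∈ R, ∃ j ∈ C, DomRel L i j ∧ v i + b j = x := by
  classical
  simp only [domPtsL, Finset.mem_image, Finset.mem_filter, Finset.mem_product, Prod.exists]
  constructor
  · rintro ⟨i, j, ⟨⟨hi, hj⟩, h⟩, hx⟩; exact ⟨i, hi, j, hj, h, hx⟩
  · rintro ⟨i, hi, j, hj, h, hx⟩; exact ⟨i, j, ⟨⟨hi, hj⟩, h⟩, hx⟩

/-- Rank one: `domPtsL R C [(ρ, γ)]` is the staircase `stairPts R C ρ γ`. [folklore] -/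
theorem domPtsL_singleton (ρ : ι → ℕ) (γ : κ → ℕ) : domPtsL R C [(ρ, γ)] v b = stairPts R C ρ γ v b := by
  classical
  ext x
  rw [mem_domPtsL, mem_stairPts]
  simp only [domRel_singleton]

/-- **Peeling the head coordinate.**  With head column positions `< 2^K`, the rank-`(r+1)` dominance sum is the union over the dyadic
nodes `(ℓ, t)` of the rank-`r` dominance sums between the node's rows and columns. [folklore] -/
theorem domPtsL_cons_eq_biUnion [DecidableEq (Fin 2 → ℝ)] (ρ₁ : ι → ℕ) (γ₁ : κ → ℕ) (L : List ((ι → ℕ) × (κ → ℕ))) (K : ℕ)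
    (hC : ∀ j ∈ C, γ₁ j < 2 ^ K) :
    domPtsL R C ((ρ₁, γ₁) :: L) v b =
      (Finset.Icc 1 K ×ˢ Finset.range (2 ^ K)).biUnion fun n => domPtsL (nodeRows R ρ₁ n) (nodeCols C γ₁ n) L v b := by
  classical
  ext x
  rw [mem_domPtsL, Finset.mem_biUnion]
  constructor
  · rintro ⟨i, hi, j, hj, h, rfl⟩
    rw [domRel_cons] at h
    obtain ⟨h1, h2⟩ := h
    obtain ⟨ℓ, t, hℓ1, hℓK, hρ, hγ⟩ := exists_dyadic_split K (ρ₁ i) (γ₁ j) h1 (hC j hj)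
    have ht : t < 2 ^ K := by
      have h3 : γ₁ j / 2 ^ (ℓ - 1) ≤ γ₁ j := Nat.div_le_self _ _
      have := hC j hj
      omega
    refine ⟨(ℓ, t), Finset.mem_product.2 ⟨Finset.mem_Icc.2 ⟨hℓ1, hℓK⟩, Finset.mem_range.2 ht⟩, ?_⟩
    exact mem_domPtsL.2 ⟨i, Finset.mem_filter.2 ⟨hi, hρ⟩, j, Finset.mem_filter.2 ⟨hj, hγ⟩, h2, rfl⟩
  · rintro ⟨n, -, hx⟩
    obtain ⟨i, hi, j, hj, h2, rfl⟩ := mem_domPtsL.1 hx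
    obtain ⟨hiR, hρ⟩ := Finset.mem_filter.1 hi
    obtain ⟨hjC, hγ⟩ := Finset.mem_filter.1 hj
    exact ⟨i, hiR, j, hjC, domRel_cons.2 ⟨lt_of_dyadic_split hρ hγ, h2⟩, rfl⟩

/-- **THE RANK-`r+1` DOMINANCE HULL BOUND.**  For a list `L` of `r` coordinate pairs whose column positions are `< 2^K` on `C` and a last
pair `(ρ, γ)` with injective positions, `#vert conv domPtsL R C (L ++ [(ρ, γ)]) ≤ 4·K^r·(#R + #C)`. [folklore] -/
theorem ncard_extremePoints_domPtsL_le {ρ : ι → ℕ} {γ : κ → ℕ} (hρ : Function.Injective ρ) (hγ : Function.Injective γ) (K : ℕ) :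
    ∀ (L : List ((ι → ℕ) × (κ → ℕ))) (R : Finset ι) (C : Finset κ), (∀ p ∈ L, ∀ j ∈ C, p.2 j < 2 ^ K) →
      ((convexHull ℝ (domPtsL R C (L ++ [(ρ, γ)]) v b : Set (Fin 2 → ℝ))).extremePoints ℝ).ncard ≤
        4 * K ^ L.length * (R.card + C.card) := by
  classical
  intro L
  induction L with
  | nil =>
    intro R C _
    rw [List.nil_append, domPtsL_singleton, List.length_nil, pow_zero, mul_one]
    exact ncard_extremePoints_stairPts_le hρ hγ
  | cons p L ih =>
    intro R C hC
    obtain ⟨ρ₁, γ₁⟩ := p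
    have hC₁ : ∀ j ∈ C, γ₁ j < 2 ^ K := fun j hj => hC (ρ₁, γ₁) (by simp) j hj
    have hCL : ∀ p ∈ L, ∀ j ∈ C, p.2 j < 2 ^ K := fun p hp j hj => hC p (by simp [hp]) j hj
    set N := Finset.Icc 1 K ×ˢ Finset.range (2 ^ K) with hN
    rw [List.cons_append, domPtsL_cons_eq_biUnion ρ₁ γ₁ (L ++ [(ρ, γ)]) K hC₁]
    refine (ncard_extremePoints_biUnion_le N _).trans ?_
    have hnode : ∀ n ∈ N, ((convexHull ℝ (domPtsL (nodeRows R ρ₁ n) (nodeCols C γ₁ n) (L ++ [(ρ, γ)]) v b :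
        Set (Fin 2 → ℝ))).extremePoints ℝ).ncard ≤ 4 * K ^ L.length * ((nodeRows R ρ₁ n).card + (nodeCols C γ₁ n).card) :=
      fun n _ => ih _ _ fun p hp j hj => hCL p hp j (Finset.mem_filter.1 hj).1
    refine (Finset.sum_le_sum hnode).trans ?_
    calc ∑ n ∈ N, 4 * K ^ L.length * ((nodeRows R ρ₁ n).card + (nodeCols C γ₁ n).card)
        = 4 * K ^ L.length * (∑ ℓ ∈ Finset.Icc 1 K, (∑ t ∈ Finset.range (2 ^ K), (nodeRows R ρ₁ (ℓ, t)).card +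
            ∑ t ∈ Finset.range (2 ^ K), (nodeCols C γ₁ (ℓ, t)).card)) := by
          rw [← Finset.mul_sum, hN, Finset.sum_product]
          congr 1
          refine Finset.sum_congr rfl fun ℓ _ => ?_
          rw [Finset.sum_add_distrib]
      _ ≤ 4 * K ^ L.length * (∑ _ℓ ∈ Finset.Icc 1 K, (R.card + C.card)) := by
          gcongr with ℓ hℓ
          · exact sum_card_filter_eq_le R (fun i => ρ₁ i / 2 ^ (ℓ - 1)) (fun t => 2 * t)
              (fun t t' (h : 2 * t = 2 * t') => by omega) _
          · exact sum_card_filter_eq_le C (fun j => γ₁ j / 2 ^ (ℓ - 1)) (fun t => 2 * t + 1)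
              (fun t t' (h : 2 * t + 1 = 2 * t' + 1) => by omega) _
      _ = 4 * K ^ (L.length + 1) * (R.card + C.card) := by
          rw [Finset.sum_const, Nat.card_Icc, smul_eq_mul, Nat.add_sub_cancel, pow_succ]; ring
      _ = 4 * K ^ ((ρ₁, γ₁) :: L).length * (R.card + C.card) := by rw [List.length_cons]

/-- The rank-`r+1` bound with first `r` column positions `< M`: `≤ 4·(Nat.size M)^r·(#R + #C) = O((#R+#C) log^r M)`. [folklore] -/
theorem ncard_extremePoints_domPtsL_le_size {ρ : ι → ℕ} {γ : κ → ℕ} (hρ : Function.Injective ρ) (hγ : Function.Injective γ)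
    (M : ℕ) (L : List ((ι → ℕ) × (κ → ℕ))) (R : Finset ι) (C : Finset κ) (hC : ∀ p ∈ L, ∀ j ∈ C, p.2 j < M) :
    ((convexHull ℝ (domPtsL R C (L ++ [(ρ, γ)]) v b : Set (Fin 2 → ℝ))).extremePoints ℝ).ncard ≤
      4 * Nat.size M ^ L.length * (R.card + C.card) :=
  ncard_extremePoints_domPtsL_le hρ hγ (Nat.size M) L R C fun p hp j hj => (hC p hp j hj).trans (Nat.lt_size_self M)

end Geometry

end Stair

end TotalsLaw

end Summit.ValiantsHypothesis.ValiantsHypothesis.Theorems.NewtonUnitEquationsDissociatedUniform
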